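import Literature.Probability.LatticeModels.RandomClusterClosedCut
import Literature.Probability.LatticeModels.RandomClusterComparisonRatio
import Literature.Probability.LatticeModels.RandomClusterFiniteVolumePressure
import HarnessLib

/-!
# FK-continuity cell, FO-10a (pressure layer, file 1): near-multiplicativity of the free random-cluster
# partition function across a seam — Grimmett 2006, (3.62) and Thm. (3.63) on ONE finite vertex type

Registered R83 (cell INBOX l.6084, 2026-08-24); registry row FO-10a-g338; label PRS-A (coordinator fk-4 g187).
Cell `fk-continuity` (bschramm), row FO-10a (domain-Markov + comparison layer over FO-06); support file for the
FK-continuity transplant (`--supports stmt-CriticalPhenomena-4575`); builds on p205010 (kernel theorem, internal audit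
signed; external expert review pending). Pure proofs; no definitions, no named facts, no sorries; arbitrary finite graphs.
UNCONDITIONAL finite-volume structure — the input of the thermodynamic limit of the pressure (Grimmett 2006, Thm. (4.58));
it decides nothing about FH / TP_FK / the value of `p_c(q)`.

For `q ≥ 1`, `0 ≤ p ≤ 1` and the partition function `Z^B_G = rcPartitionFunction G p q B` (Literature `RandomCluster.lean`):

* `sum_powerset_union_eq_sum_sum` (sub-configurations of a disjoint union, nested-sum form), `sum_powerset_pow_mul_pow_eq_one`
  (`∑_{σ ⊆ S} p^{|σ|}(1-p)^{|S∖σ|} = 1`) — bookkeeping;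
* `clusterCount_empty_empty_eq_natCard`, **`clusterCount_union_add_natCard_eq`** (`k(ω₁ ∪ ω₂) + |U| = k(ω₁) + k(ω₂)` when the
  edges of `ω₁` lie inside `A` and those of `ω₂` inside `Aᶜ` — the cluster count behind (3.62), via Literature
  `clusterCount_union_add_eq_of_closed_cut`), `clusterCount_union_le_left`, `clusterCount_le_clusterCount_union_add_card`
  (`k(ω ∪ σ) ≤ k(ω) ≤ k(ω ∪ σ) + |σ|`, (3.64));
* `one_le_rcPartitionFunction`, `rcPartitionFunction_le_pow_card`, `log_rcPartitionFunction_mem_Icc` — the a priori bounds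
  `1 ≤ Z^B_G ≤ q^{|V|}` ((3.59): `Z = φ_p(q^{k})`, `0 ≤ k ≤ |V|`);
* `rcWeight_mul_rcWeight_mul_eq`, `rcWeight_union_mul_pow_card_le`, `rcWeight_mul_rcWeight_mul_le_pow_mul`,
  `rcPartitionFunction_eq_sum_sum_sum`, **`rcPartitionFunction_mul_pow_card_le_mul`**, **`mul_le_pow_mul_rcPartitionFunction`** —
  for subgraphs `H₁, H₂ ≤ H` on one finite vertex type `U` with the edges of `H₁` inside `A` and those of `H₂` inside `Aᶜ`, and
  `S = E(H) ∖ (E(H₁) ∪ E(H₂))` the seam: `q^{|U|} Z⁰_H ≤ Z⁰_{H₁} Z⁰_{H₂} ≤ q^{|U| + |S|} Z⁰_H` (Grimmett 2006, (3.62)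
  `Z_{G₁ ∪ G₂} = Z_{G₁} Z_{G₂}` and Thm. (3.63) `Z_{G₁} Z_{G₂} (1 ∨ q)^{-|F|} ≤ Z_G ≤ Z_{G₁} Z_{G₂} (1 ∧ q)^{-|F|}`, the idle vertices
  of `H₁`, `H₂` being kept, whence the factor `q^{|U|}`; proved termwise on the triple sum, no product graph needed).

The companion `PartitionFunctionDecomposition.lean` specialises this to the finite pieces `finsetGraph G Λ` of a locally finite
graph (`|log Z⁰_Λ - log Z⁰_{Λ₁} - log Z⁰_{Λ∖Λ₁}| ≤ |∂ᵉΛ₁| log q`) and records translation invariance on `ℤ^d`.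

Honest framing: finite-graph identities and inequalities; no statement about `p_c(q)`; NOT a binder discharge, NOT `_r4`.

## References

* G. Grimmett, *The Random-Cluster Model*, Springer 2006 (`book:grimmett2006-random-cluster-model`): §3.6 (3.55), (3.59),
  Thm. (3.60) with (3.64)–(3.65), (3.62), Thm. (3.63) [PDF pp. 56–57]; §4.5, proof of Thm. (4.58), (4.65) [PDF pp. 90–92].
  [Grimmett2006]
-/

noncomputable section

open Finset SimpleGraph

namespace Summit.CriticalPhenomena.PercolationContinuityZ3.Theorems.FK

open Literature.Probability.Percolation Literature.Probability.LatticeModels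

/-! ### Bookkeeping: sub-configurations of a disjoint union, the Bernoulli normalisation -/

section Bookkeeping

variable {α : Type*} [DecidableEq α] {M : Type*} [AddCommMonoid M]

/-- Sub-configurations of a disjoint union `s ∪ t` are the unions `a ∪ b`, `a ⊆ s`, `b ⊆ t`, bijectively:
the nested-sum form. [folklore] -/
theorem sum_powerset_union_eq_sum_sum {s t : Finset α} (hst : Disjoint s t) (f : Finset α → M) :
    ∑ W ∈ (s ∪ t).powerset, f W = ∑ a ∈ s.powerset, ∑ b ∈ t.powerset, f (a ∪ b) := by
  rw [← Finset.sum_product']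
  refine Finset.sum_nbij' (fun W => (W ∩ s, W ∩ t)) (fun c => c.1 ∪ c.2) ?_ ?_ ?_ ?_ ?_
  · intro W _
    simp only [Finset.mem_product, Finset.mem_powerset]
    exact ⟨Finset.inter_subset_right, Finset.inter_subset_right⟩
  · intro c hc
    rw [Finset.mem_product, Finset.mem_powerset, Finset.mem_powerset] at hc
    rw [Finset.mem_powerset]
    exact Finset.union_subset_union hc.1 hc.2
  · intro W hW
    rw [Finset.mem_powerset] at hW
    dsimp only
    rw [← Finset.inter_union_distrib_left, Finset.inter_eq_left.2 hW]
  · intro c hc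
    rw [Finset.mem_product, Finset.mem_powerset, Finset.mem_powerset] at hc
    obtain ⟨h₁, h₂⟩ := hc
    have hd : Disjoint c.2 s := (hst.symm).mono_left h₂
    have hd' : Disjoint c.1 t := hst.mono_left h₁
    ext <;> simp only [Finset.union_inter_distrib_right, Finset.inter_eq_left.2 h₁,
      Finset.disjoint_iff_inter_eq_empty.1 hd, Finset.union_empty, Finset.inter_eq_left.2 h₂,
      Finset.disjoint_iff_inter_eq_empty.1 hd', Finset.empty_union]
  · intro W hW
    rw [Finset.mem_powerset] at hW
    dsimp only
    rw [← Finset.inter_union_distrib_left, Finset.inter_eq_left.2 hW]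

/-- The Bernoulli weights of the sub-configurations of `S` sum to one:
`∑_{σ ⊆ S} p^{|σ|} (1-p)^{|S ∖ σ|} = (p + (1 - p))^{|S|} = 1`. [folklore] -/
theorem sum_powerset_pow_mul_pow_eq_one (p : ℝ) (S : Finset α) :
    ∑ σ ∈ S.powerset, p ^ #σ * (1 - p) ^ #(S \ σ) = 1 := by
  have h := Finset.sum_pow_mul_eq_add_pow p (1 - p) S
  rw [add_sub_cancel, one_pow] at h
  refine Eq.trans (Finset.sum_congr rfl fun σ hσ => ?_) h
  rw [Finset.card_sdiff_of_subset (Finset.mem_powerset.1 hσ)]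

end Bookkeeping

/-! ### Cluster counts of configurations supported on the two sides of a vertex partition -/

section ClusterCount

variable {U : Type*}

/-- The empty configuration with nothing wired has one cluster per vertex. [cite: Grimmett2006, §1.2 eq. (1.1)] -/
theorem clusterCount_empty_empty_eq_natCard :
    clusterCount (∅ : BondConfig U) (∅ : Set U) = Nat.card U := by
  unfold clusterCount
  rw [wired_empty, sup_bot_eq, openGraph, SimpleGraph.fromEdgeSet_empty]
  refine Nat.card_congr ⟨ConnectedComponent.lift id fun u v w _ => ?_, (⊥ : SimpleGraph U).connectedComponentMk,
    ?_, fun v => ConnectedComponent.lift_mk⟩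
  · cases w with
    | nil => rfl
    | cons h _ => exact ((bot_adj _ _).1 h).elim
  · intro c
    induction c using ConnectedComponent.ind with
    | h v => rfl

variable [Finite U]

/-- **Additivity of the cluster count across a vertex partition with no open crossing edge** (the
cluster count behind Grimmett 2006, (3.62) `Z_{G₁ ∪ G₂} = Z_{G₁} Z_{G₂}`, with the idle vertices of each side
kept as singletons): if every edge of `ω₁` lies inside `A` and every edge of `ω₂` inside `Aᶜ`, then
`k(ω₁ ∪ ω₂) + |U| = k(ω₁) + k(ω₂)`. [cite: Grimmett2006, §3.6 (3.62)] -/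
theorem clusterCount_union_add_natCard_eq [DecidableEq U] (A : Set U) {ω₁ ω₂ : Finset (Sym2 U)}
    (h₁ : ∀ e ∈ ω₁, ∀ x ∈ e, x ∈ A) (h₂ : ∀ e ∈ ω₂, ∀ x ∈ e, x ∉ A) :
    clusterCount (↑(ω₁ ∪ ω₂) : BondConfig U) ∅ + Nat.card U =
      clusterCount (↑ω₁ : BondConfig U) ∅ + clusterCount (↑ω₂ : BondConfig U) ∅ := by
  have h := clusterCount_union_add_eq_of_closed_cut ω₂ (↑ω₁ : Set (Sym2 U)) (B := (∅ : Set U)) (S := A)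
    h₂ (fun e he => h₁ e he)
  rw [Set.empty_sdiff, clusterCount_empty_empty_eq_natCard, Set.union_comm] at h
  rw [Finset.coe_union]
  exact h

/-- Opening the seam edges `σ` lowers the cluster count: `k(ω ∪ σ) ≤ k(ω)`. [cite: Grimmett2006, Thm. (3.60) (proof, (3.64))] -/
theorem clusterCount_union_le_left [DecidableEq U] (ω σ : Finset (Sym2 U)) (B : Set U) :
    clusterCount (↑(ω ∪ σ) : BondConfig U) B ≤ clusterCount (↑ω : BondConfig U) B := by
  refine clusterCount_anti ?_ B
  rw [Finset.coe_union]
  exact Set.subset_union_left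

/-- Opening the seam edges `σ` lowers the cluster count by at most `|σ|`: `k(ω) ≤ k(ω ∪ σ) + |σ|`.
[cite: Grimmett2006, Thm. (3.60) (proof, (3.64))] -/
theorem clusterCount_le_clusterCount_union_add_card [DecidableEq U] (ω σ : Finset (Sym2 U)) (B : Set U) :
    clusterCount (↑ω : BondConfig U) B ≤ clusterCount (↑(ω ∪ σ) : BondConfig U) B + #σ := by
  refine (clusterCount_le_clusterCount_add_card_sdiff (Finset.subset_union_left (s₂ := σ)) B).trans ?_
  refine Nat.add_le_add_left (Finset.card_le_card ?_) _
  intro e he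
  rw [Finset.mem_sdiff, Finset.mem_union] at he
  tauto

end ClusterCount

/-! ### A priori bounds: `1 ≤ Z ≤ q^{|V|}` for `q ≥ 1` -/

section APriori

variable {V : Type*} [Fintype V] [DecidableEq V] (G : SimpleGraph V) [DecidableRel G.Adj]

/-- **`Z^B_G(p,q) ≥ 1` for `q ≥ 1`**: `Z = φ_p(q^{k})` and `q^k ≥ 1`. [cite: Grimmett2006, §3.6 (3.59)] -/
theorem one_le_rcPartitionFunction {p q : ℝ} (hp : p ∈ Set.Icc (0 : ℝ) 1) (hq : 1 ≤ q) (B : Set V) :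
    1 ≤ rcPartitionFunction G p q B := by
  rw [rcPartitionFunction, ← sum_powerset_pow_mul_pow_eq_one p G.edgeFinset]
  refine Finset.sum_le_sum fun ω _ => ?_
  unfold rcWeight
  have h0 : 0 ≤ p ^ #ω * (1 - p) ^ #(G.edgeFinset \ ω) :=
    mul_nonneg (pow_nonneg hp.1 _) (pow_nonneg (sub_nonneg.2 hp.2) _)
  exact le_mul_of_one_le_right h0 (one_le_pow₀ hq)

/-- **`Z^B_G(p,q) ≤ q^{|V|}` for `q ≥ 1`**: `k^B(ω) ≤ k^∅(∅) = |V|`. [cite: Grimmett2006, §3.6 (3.59)] -/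
theorem rcPartitionFunction_le_pow_card {p q : ℝ} (hp : p ∈ Set.Icc (0 : ℝ) 1) (hq : 1 ≤ q) (B : Set V) :
    rcPartitionFunction G p q B ≤ q ^ Fintype.card V := by
  rw [rcPartitionFunction]
  calc ∑ ω ∈ G.edgeFinset.powerset, rcWeight G p q B ω
      ≤ ∑ ω ∈ G.edgeFinset.powerset, p ^ #ω * (1 - p) ^ #(G.edgeFinset \ ω) * q ^ Fintype.card V := by
        refine Finset.sum_le_sum fun ω _ => ?_
        unfold rcWeight
        have h0 : 0 ≤ p ^ #ω * (1 - p) ^ #(G.edgeFinset \ ω) :=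
          mul_nonneg (pow_nonneg hp.1 _) (pow_nonneg (sub_nonneg.2 hp.2) _)
        refine mul_le_mul_of_nonneg_left (pow_le_pow_right₀ hq ?_) h0
        calc clusterCount (↑ω : BondConfig V) B ≤ clusterCount (↑ω : BondConfig V) ∅ :=
              clusterCount_le_clusterCount_empty _ B
          _ ≤ clusterCount ((∅ : Finset (Sym2 V)) : BondConfig V) ∅ :=
              clusterCount_anti (by simp) ∅
          _ = Fintype.card V := by
              rw [Finset.coe_empty, clusterCount_empty_empty_eq_natCard, Nat.card_eq_fintype_card]
    _ = q ^ Fintype.card V := by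
        rw [← Finset.sum_mul, sum_powerset_pow_mul_pow_eq_one, one_mul]

/-- In logarithmic form: `0 ≤ log Z^B_G ≤ |V| log q`. [cite: Grimmett2006, §3.6 (3.59)] -/
theorem log_rcPartitionFunction_mem_Icc {p q : ℝ} (hp : p ∈ Set.Icc (0 : ℝ) 1) (hq : 1 ≤ q) (B : Set V) :
    Real.log (rcPartitionFunction G p q B) ∈ Set.Icc 0 ((Fintype.card V : ℝ) * Real.log q) := by
  have h1 := one_le_rcPartitionFunction G hp hq B
  refine ⟨Real.log_nonneg h1, ?_⟩
  rw [← Real.log_pow]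
  exact Real.log_le_log (one_pos.trans_le h1) (rcPartitionFunction_le_pow_card G hp hq B)

end APriori

/-! ### One vertex type, two edge-disjointly supported subgraphs: `q^{|U|} Z_H ≤ Z_{H₁} Z_{H₂} ≤ q^{|U|+|S|} Z_H` -/

section OneType

variable {U : Type*} [Fintype U] [DecidableEq U] (H H₁ H₂ : SimpleGraph U) [DecidableRel H.Adj]
  [DecidableRel H₁.Adj] [DecidableRel H₂.Adj] (A : Set U)

/-- Shared bookkeeping for the two weight comparisons: with `S = E(H) ∖ (E(H₁) ∪ E(H₂))` the seam edges,
`E(H) = E(H₁) ⊔ E(H₂) ⊔ S`, and for `ω₁ ⊆ E(H₁)`, `ω₂ ⊆ E(H₂)`, `σ ⊆ S` the product of the free weights of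
`ω₁` in `H₁`, `ω₂` in `H₂` and the Bernoulli weight of `σ` in `S` is the free weight of `ω₁ ∪ ω₂ ∪ σ` in `H`
with `q^{k(ω₁ ∪ ω₂ ∪ σ)}` replaced by `q^{k(ω₁) + k(ω₂)}`. [cite: Grimmett2006, §3.6 (3.62) and (3.65)] -/
theorem rcWeight_mul_rcWeight_mul_eq (p q : ℝ) (h₁ : H₁ ≤ H) (h₂ : H₂ ≤ H)
    (hA₁ : ∀ e ∈ H₁.edgeFinset, ∀ x ∈ e, x ∈ A) (hA₂ : ∀ e ∈ H₂.edgeFinset, ∀ x ∈ e, x ∉ A)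
    {ω₁ ω₂ σ : Finset (Sym2 U)} (hω₁ : ω₁ ⊆ H₁.edgeFinset) (hω₂ : ω₂ ⊆ H₂.edgeFinset)
    (hσ : σ ⊆ H.edgeFinset \ (H₁.edgeFinset ∪ H₂.edgeFinset)) :
    rcWeight H₁ p q ∅ ω₁ * rcWeight H₂ p q ∅ ω₂ *
        (p ^ #σ * (1 - p) ^ #((H.edgeFinset \ (H₁.edgeFinset ∪ H₂.edgeFinset)) \ σ)) =
      p ^ #(ω₁ ∪ ω₂ ∪ σ) * (1 - p) ^ #(H.edgeFinset \ (ω₁ ∪ ω₂ ∪ σ)) *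
        q ^ (clusterCount (↑ω₁ : BondConfig U) ∅ + clusterCount (↑ω₂ : BondConfig U) ∅) := by
  set S := H.edgeFinset \ (H₁.edgeFinset ∪ H₂.edgeFinset) with hS
  have hE₁ : H₁.edgeFinset ⊆ H.edgeFinset := edgeFinset_subset_edgeFinset.2 h₁
  have hE₂ : H₂.edgeFinset ⊆ H.edgeFinset := edgeFinset_subset_edgeFinset.2 h₂
  have hd12 : Disjoint H₁.edgeFinset H₂.edgeFinset := by
    rw [Finset.disjoint_left]
    intro e he₁ he₂
    induction e using Sym2.ind with
    | h x y => exact hA₂ _ he₂ x (Sym2.mem_mk_left x y) (hA₁ _ he₁ x (Sym2.mem_mk_left x y))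
  have hdS : Disjoint (H₁.edgeFinset ∪ H₂.edgeFinset) S := by
    rw [hS]; exact Finset.disjoint_sdiff
  have hdec : H.edgeFinset = H₁.edgeFinset ∪ H₂.edgeFinset ∪ S := by
    rw [hS, Finset.union_sdiff_of_subset (Finset.union_subset hE₁ hE₂)]
  have hcardE : #H.edgeFinset = #H₁.edgeFinset + #H₂.edgeFinset + #S := by
    conv_lhs => rw [hdec]
    rw [Finset.card_union_of_disjoint hdS, Finset.card_union_of_disjoint hd12]
  have hsubω : ω₁ ∪ ω₂ ∪ σ ⊆ H.edgeFinset := by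
    rw [hdec]
    exact Finset.union_subset_union (Finset.union_subset_union hω₁ hω₂) hσ
  have hcardo : #(ω₁ ∪ ω₂ ∪ σ) = #ω₁ + #ω₂ + #σ := by
    rw [Finset.card_union_of_disjoint, Finset.card_union_of_disjoint]
    · exact Finset.disjoint_of_subset_left hω₁ (Finset.disjoint_of_subset_right hω₂ hd12)
    · exact Finset.disjoint_of_subset_left (Finset.union_subset_union hω₁ hω₂)
        (Finset.disjoint_of_subset_right hσ hdS)
  have hcard : #(H.edgeFinset \ (ω₁ ∪ ω₂ ∪ σ)) =
      #(H₁.edgeFinset \ ω₁) + #(H₂.edgeFinset \ ω₂) + #(S \ σ) := by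
    rw [Finset.card_sdiff_of_subset hsubω, Finset.card_sdiff_of_subset hω₁,
      Finset.card_sdiff_of_subset hω₂, Finset.card_sdiff_of_subset hσ, hcardE, hcardo]
    have l₁ := Finset.card_le_card hω₁
    have l₂ := Finset.card_le_card hω₂
    have l₃ := Finset.card_le_card hσ
    omega
  unfold rcWeight
  rw [hcard, hcardo, pow_add, pow_add, pow_add, pow_add, pow_add]
  ring

/-- The free weight of `ω₁ ∪ ω₂ ∪ σ` in `H` against the product of the free weights of `ω₁` in `H₁` and
`ω₂` in `H₂` and the Bernoulli weight of `σ` among the seam edges `S = E(H) ∖ (E(H₁) ∪ E(H₂))`: the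
`p`-parts agree and `k(ω₁ ∪ ω₂ ∪ σ) + |U| ≤ k(ω₁) + k(ω₂)`.
[cite: Grimmett2006, Thm. (3.63) (upper bound, via (3.62) and (3.61))] -/
theorem rcWeight_union_mul_pow_card_le {p q : ℝ} (hp : p ∈ Set.Icc (0 : ℝ) 1) (hq : 1 ≤ q)
    (h₁ : H₁ ≤ H) (h₂ : H₂ ≤ H) (hA₁ : ∀ e ∈ H₁.edgeFinset, ∀ x ∈ e, x ∈ A)
    (hA₂ : ∀ e ∈ H₂.edgeFinset, ∀ x ∈ e, x ∉ A)
    {ω₁ ω₂ σ : Finset (Sym2 U)} (hω₁ : ω₁ ⊆ H₁.edgeFinset) (hω₂ : ω₂ ⊆ H₂.edgeFinset)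
    (hσ : σ ⊆ H.edgeFinset \ (H₁.edgeFinset ∪ H₂.edgeFinset)) :
    rcWeight H p q ∅ (ω₁ ∪ ω₂ ∪ σ) * q ^ Fintype.card U ≤
      rcWeight H₁ p q ∅ ω₁ * rcWeight H₂ p q ∅ ω₂ *
        (p ^ #σ * (1 - p) ^ #((H.edgeFinset \ (H₁.edgeFinset ∪ H₂.edgeFinset)) \ σ)) := by
  rw [rcWeight_mul_rcWeight_mul_eq H H₁ H₂ A p q h₁ h₂ hA₁ hA₂ hω₁ hω₂ hσ]
  have hk : clusterCount (↑(ω₁ ∪ ω₂ ∪ σ) : BondConfig U) ∅ + Fintype.card U ≤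
      clusterCount (↑ω₁ : BondConfig U) ∅ + clusterCount (↑ω₂ : BondConfig U) ∅ := by
    have hadd := clusterCount_union_add_natCard_eq A (ω₁ := ω₁) (ω₂ := ω₂)
      (fun e he => hA₁ e (hω₁ he)) (fun e he => hA₂ e (hω₂ he))
    rw [Nat.card_eq_fintype_card] at hadd
    rw [← hadd]
    exact Nat.add_le_add_right (clusterCount_union_le_left (ω₁ ∪ ω₂) σ ∅) _
  have h0 : 0 ≤ p ^ #(ω₁ ∪ ω₂ ∪ σ) * (1 - p) ^ #(H.edgeFinset \ (ω₁ ∪ ω₂ ∪ σ)) :=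
    mul_nonneg (pow_nonneg hp.1 _) (pow_nonneg (sub_nonneg.2 hp.2) _)
  unfold rcWeight
  rw [mul_assoc, ← pow_add]
  exact mul_le_mul_of_nonneg_left (pow_le_pow_right₀ hq hk) h0

/-- The reverse comparison of weights: `k(ω₁) + k(ω₂) = k(ω₁ ∪ ω₂) + |U| ≤ k(ω₁ ∪ ω₂ ∪ σ) + |σ| + |U|`.
[cite: Grimmett2006, Thm. (3.63) (lower bound, via (3.62) and (3.61))] -/
theorem rcWeight_mul_rcWeight_mul_le_pow_mul {p q : ℝ} (hp : p ∈ Set.Icc (0 : ℝ) 1) (hq : 1 ≤ q)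
    (h₁ : H₁ ≤ H) (h₂ : H₂ ≤ H) (hA₁ : ∀ e ∈ H₁.edgeFinset, ∀ x ∈ e, x ∈ A)
    (hA₂ : ∀ e ∈ H₂.edgeFinset, ∀ x ∈ e, x ∉ A)
    {ω₁ ω₂ σ : Finset (Sym2 U)} (hω₁ : ω₁ ⊆ H₁.edgeFinset) (hω₂ : ω₂ ⊆ H₂.edgeFinset)
    (hσ : σ ⊆ H.edgeFinset \ (H₁.edgeFinset ∪ H₂.edgeFinset)) :
    rcWeight H₁ p q ∅ ω₁ * rcWeight H₂ p q ∅ ω₂ *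
        (p ^ #σ * (1 - p) ^ #((H.edgeFinset \ (H₁.edgeFinset ∪ H₂.edgeFinset)) \ σ)) ≤
      q ^ (Fintype.card U + #(H.edgeFinset \ (H₁.edgeFinset ∪ H₂.edgeFinset))) *
        rcWeight H p q ∅ (ω₁ ∪ ω₂ ∪ σ) := by
  rw [rcWeight_mul_rcWeight_mul_eq H H₁ H₂ A p q h₁ h₂ hA₁ hA₂ hω₁ hω₂ hσ]
  have hk : clusterCount (↑ω₁ : BondConfig U) ∅ + clusterCount (↑ω₂ : BondConfig U) ∅ ≤
      Fintype.card U + #(H.edgeFinset \ (H₁.edgeFinset ∪ H₂.edgeFinset)) +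
        clusterCount (↑(ω₁ ∪ ω₂ ∪ σ) : BondConfig U) ∅ := by
    have hadd := clusterCount_union_add_natCard_eq A (ω₁ := ω₁) (ω₂ := ω₂)
      (fun e he => hA₁ e (hω₁ he)) (fun e he => hA₂ e (hω₂ he))
    rw [Nat.card_eq_fintype_card] at hadd
    rw [← hadd]
    have h3 := clusterCount_le_clusterCount_union_add_card (ω₁ ∪ ω₂) σ (∅ : Set U)
    have h4 := Finset.card_le_card hσ
    omega
  have h0 : 0 ≤ p ^ #(ω₁ ∪ ω₂ ∪ σ) * (1 - p) ^ #(H.edgeFinset \ (ω₁ ∪ ω₂ ∪ σ)) :=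
    mul_nonneg (pow_nonneg hp.1 _) (pow_nonneg (sub_nonneg.2 hp.2) _)
  unfold rcWeight
  calc p ^ #(ω₁ ∪ ω₂ ∪ σ) * (1 - p) ^ #(H.edgeFinset \ (ω₁ ∪ ω₂ ∪ σ)) *
          q ^ (clusterCount (↑ω₁ : BondConfig U) ∅ + clusterCount (↑ω₂ : BondConfig U) ∅)
      ≤ p ^ #(ω₁ ∪ ω₂ ∪ σ) * (1 - p) ^ #(H.edgeFinset \ (ω₁ ∪ ω₂ ∪ σ)) *
          q ^ (Fintype.card U + #(H.edgeFinset \ (H₁.edgeFinset ∪ H₂.edgeFinset)) +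
            clusterCount (↑(ω₁ ∪ ω₂ ∪ σ) : BondConfig U) ∅) :=
        mul_le_mul_of_nonneg_left (pow_le_pow_right₀ hq hk) h0
    _ = _ := by rw [pow_add]; ring

/-- The free partition function of `H` as a triple sum over the configurations on `E(H₁)`, `E(H₂)` and the
seam. [cite: Grimmett2006, §3.6 (3.55) and (3.65)] -/
theorem rcPartitionFunction_eq_sum_sum_sum (p q : ℝ) (h₁ : H₁ ≤ H) (h₂ : H₂ ≤ H)
    (hA₁ : ∀ e ∈ H₁.edgeFinset, ∀ x ∈ e, x ∈ A) (hA₂ : ∀ e ∈ H₂.edgeFinset, ∀ x ∈ e, x ∉ A) :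
    rcPartitionFunction H p q ∅ =
      ∑ ω₁ ∈ H₁.edgeFinset.powerset, ∑ ω₂ ∈ H₂.edgeFinset.powerset,
        ∑ σ ∈ (H.edgeFinset \ (H₁.edgeFinset ∪ H₂.edgeFinset)).powerset,
          rcWeight H p q ∅ (ω₁ ∪ ω₂ ∪ σ) := by
  have hE₁ : H₁.edgeFinset ⊆ H.edgeFinset := edgeFinset_subset_edgeFinset.2 h₁
  have hE₂ : H₂.edgeFinset ⊆ H.edgeFinset := edgeFinset_subset_edgeFinset.2 h₂
  have hd12 : Disjoint H₁.edgeFinset H₂.edgeFinset := by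
    rw [Finset.disjoint_left]
    intro e he₁ he₂
    induction e using Sym2.ind with
    | h x y => exact hA₂ _ he₂ x (Sym2.mem_mk_left x y) (hA₁ _ he₁ x (Sym2.mem_mk_left x y))
  have hdS : Disjoint (H₁.edgeFinset ∪ H₂.edgeFinset) (H.edgeFinset \ (H₁.edgeFinset ∪ H₂.edgeFinset)) :=
    Finset.disjoint_sdiff
  have hdec : H.edgeFinset =
      H₁.edgeFinset ∪ H₂.edgeFinset ∪ (H.edgeFinset \ (H₁.edgeFinset ∪ H₂.edgeFinset)) := by
    rw [Finset.union_sdiff_of_subset (Finset.union_subset hE₁ hE₂)]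
  rw [rcPartitionFunction]
  conv_lhs => rw [hdec]
  rw [sum_powerset_union_eq_sum_sum hdS, sum_powerset_union_eq_sum_sum hd12]

/-- **`q^{|U|} Z_H ≤ Z_{H₁} Z_{H₂}`** (free boundary conditions, `q ≥ 1`): Grimmett 2006, (3.62) with the upper
bound of Thm. (3.63), for two subgraphs `H₁, H₂ ≤ H` on ONE vertex type whose edges lie inside `A`, resp.
inside `Aᶜ` (the idle vertices of `H₁`, `H₂` account for the factor `q^{|U|}`).
[cite: Grimmett2006, Thm. (3.63) (Z_G ≤ Z_{G₁} Z_{G₂} (1 ∧ q)^{-|F|})] -/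
theorem rcPartitionFunction_mul_pow_card_le_mul {p q : ℝ} (hp : p ∈ Set.Icc (0 : ℝ) 1) (hq : 1 ≤ q)
    (h₁ : H₁ ≤ H) (h₂ : H₂ ≤ H) (hA₁ : ∀ e ∈ H₁.edgeFinset, ∀ x ∈ e, x ∈ A)
    (hA₂ : ∀ e ∈ H₂.edgeFinset, ∀ x ∈ e, x ∉ A) :
    rcPartitionFunction H p q ∅ * q ^ Fintype.card U ≤
      rcPartitionFunction H₁ p q ∅ * rcPartitionFunction H₂ p q ∅ := by
  rw [rcPartitionFunction_eq_sum_sum_sum H H₁ H₂ A p q h₁ h₂ hA₁ hA₂, Finset.sum_mul, rcPartitionFunction,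
    rcPartitionFunction, Finset.sum_mul_sum]
  refine Finset.sum_le_sum fun ω₁ hω₁ => ?_
  rw [Finset.sum_mul]
  refine Finset.sum_le_sum fun ω₂ hω₂ => ?_
  rw [Finset.sum_mul, ← mul_one (rcWeight H₁ p q ∅ ω₁ * rcWeight H₂ p q ∅ ω₂),
    ← sum_powerset_pow_mul_pow_eq_one p (H.edgeFinset \ (H₁.edgeFinset ∪ H₂.edgeFinset)), Finset.mul_sum]
  exact Finset.sum_le_sum fun σ hσ => rcWeight_union_mul_pow_card_le H H₁ H₂ A hp hq h₁ h₂ hA₁ hA₂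
    (Finset.mem_powerset.1 hω₁) (Finset.mem_powerset.1 hω₂) (Finset.mem_powerset.1 hσ)

/-- **`Z_{H₁} Z_{H₂} ≤ q^{|U| + |S|} Z_H`** (free boundary conditions, `q ≥ 1`, `S` the seam edges): Grimmett
2006, (3.62) with the lower bound of Thm. (3.63).
[cite: Grimmett2006, Thm. (3.63) (Z_{G₁} Z_{G₂} (1 ∨ q)^{-|F|} ≤ Z_G)] -/
theorem mul_le_pow_mul_rcPartitionFunction {p q : ℝ} (hp : p ∈ Set.Icc (0 : ℝ) 1) (hq : 1 ≤ q)
    (h₁ : H₁ ≤ H) (h₂ : H₂ ≤ H) (hA₁ : ∀ e ∈ H₁.edgeFinset, ∀ x ∈ e, x ∈ A)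
    (hA₂ : ∀ e ∈ H₂.edgeFinset, ∀ x ∈ e, x ∉ A) :
    rcPartitionFunction H₁ p q ∅ * rcPartitionFunction H₂ p q ∅ ≤
      q ^ (Fintype.card U + #(H.edgeFinset \ (H₁.edgeFinset ∪ H₂.edgeFinset))) *
        rcPartitionFunction H p q ∅ := by
  rw [rcPartitionFunction_eq_sum_sum_sum H H₁ H₂ A p q h₁ h₂ hA₁ hA₂, Finset.mul_sum, rcPartitionFunction,
    rcPartitionFunction, Finset.sum_mul_sum]
  refine Finset.sum_le_sum fun ω₁ hω₁ => ?_
  rw [Finset.mul_sum]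
  refine Finset.sum_le_sum fun ω₂ hω₂ => ?_
  rw [Finset.mul_sum, ← mul_one (rcWeight H₁ p q ∅ ω₁ * rcWeight H₂ p q ∅ ω₂),
    ← sum_powerset_pow_mul_pow_eq_one p (H.edgeFinset \ (H₁.edgeFinset ∪ H₂.edgeFinset)), Finset.mul_sum]
  exact Finset.sum_le_sum fun σ hσ => rcWeight_mul_rcWeight_mul_le_pow_mul H H₁ H₂ A hp hq h₁ h₂ hA₁ hA₂
    (Finset.mem_powerset.1 hω₁) (Finset.mem_powerset.1 hω₂) (Finset.mem_powerset.1 hσ)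

end OneType

end Summit.CriticalPhenomena.PercolationContinuityZ3.Theorems.FK
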